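import Mathlib
import Literature.GroupTheory.CombinatorialGroupTheory.SignedHurwitzAction
import Literature.GroupTheory.CombinatorialGroupTheory.SignedHurwitzStabilisation
import Literature.GroupTheory.CombinatorialGroupTheory.SignedHurwitzExchange
import HarnessLib
import Summits.SmoothPoincare4.SmoothPoincare4.Theorems.ConvexBisectionAcyclicBisectionRigidityStubMatsumotoNormalFormAux
import Summits.SmoothPoincare4.SmoothPoincare4.Theorems.ConvexBisectionAcyclicBisectionRigidityStubMatsumotoNormalFormAux4

/-!
# Matsumoto's normal form for four-letter genus-one words, V: the descent step on words

Helper file for stub D-alg (`stub_matsumotoNormalForm`), line `folded-curve-branch-locus`, crux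
`ConvexBisection.AcyclicBisectionRigidity` (item stmt-SmoothPoincare4-10507).  Back to words over
`SignedHurwitz`: the complexity `S4 = Σ_{i<j} |ω(vᵢ, vⱼ)|` of a four-letter genus-one word and
the descent step `helper_descent_step` — a word `[(v₁,ε₁),…,(v₄,ε₄)]` with two letters of each
sign, trivial signed monodromy and no cyclically adjacent opposite pair with vanishing pairing
admits one of the six signed Hurwitz moves (`HurwitzStep`, both alternatives, three positions)
strictly decreasing `S4`.  Proof: evaluate `helper_fund_identity` of the word and of its rotation
at the classes (seven identities), feed `helper_arith_moves`, and read off the move.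

Reference: Y. Matsumoto, J. Math. Soc. Japan 37 (1985), Def. 3.1, Thm. 3.2.  Everything is proved.
-/

set_option linter.dupNamespace false

namespace Summit.SmoothPoincare4.SmoothPoincare4.Theorems.AcyclicBisectionRigidity.FoldedCurveBranchLocus

open Literature.GroupTheory.CombinatorialGroupTheory.SignedHurwitz

namespace Matsumoto

/-! ## The complexity and the descent step on words -/

/-- The complexity of a four-letter genus-one word: the sum of the absolute values of the six
pairings of its classes. [folklore] -/
def S4 (v₁ v₂ v₃ v₄ : Fin 1 ⊕ Fin 1 → ℤ) : ℤ :=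
  |(stdSymp ℤ 1) v₁ v₂| + |(stdSymp ℤ 1) v₁ v₃| + |(stdSymp ℤ 1) v₁ v₄| + |(stdSymp ℤ 1) v₂ v₃| +
      |(stdSymp ℤ 1) v₂ v₄| + |(stdSymp ℤ 1) v₃ v₄|

/-- The complexity is non-negative. [folklore] -/
theorem S4_nonneg (v₁ v₂ v₃ v₄ : Fin 1 ⊕ Fin 1 → ℤ) : 0 ≤ S4 v₁ v₂ v₃ v₄ := by
  unfold S4; positivity

/-- Linearity of `ω` in the first slot along a translate. [folklore] -/
theorem om_add_smul_left (x y z : Fin 1 ⊕ Fin 1 → ℤ) (k : ℤ) : (stdSymp ℤ 1) (x + k • y) z =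
    (stdSymp ℤ 1) x z + k * (stdSymp ℤ 1) y z := by
  simp only [map_add, map_smul, LinearMap.add_apply, LinearMap.smul_apply, smul_eq_mul]

/-- Linearity of `ω` in the first slot along a translate. [folklore] -/
theorem om_sub_smul_left (x y z : Fin 1 ⊕ Fin 1 → ℤ) (k : ℤ) : (stdSymp ℤ 1) (x - k • y) z =
    (stdSymp ℤ 1) x z - k * (stdSymp ℤ 1) y z := by
  simp only [map_sub, map_smul, LinearMap.sub_apply, LinearMap.smul_apply, smul_eq_mul]

/-- Linearity of `ω` in the second slot along a translate. [folklore] -/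
theorem om_add_smul_right (x y z : Fin 1 ⊕ Fin 1 → ℤ) (k : ℤ) : (stdSymp ℤ 1) z (x + k • y) =
    (stdSymp ℤ 1) z x + k * (stdSymp ℤ 1) z y := by
  simp only [map_add, map_smul, smul_eq_mul]

/-- Linearity of `ω` in the second slot along a translate. [folklore] -/
theorem om_sub_smul_right (x y z : Fin 1 ⊕ Fin 1 → ℤ) (k : ℤ) : (stdSymp ℤ 1) z (x - k • y) =
    (stdSymp ℤ 1) z x - k * (stdSymp ℤ 1) z y := by
  simp only [map_sub, map_smul, smul_eq_mul]

/-- `sgn` is injective. [folklore] -/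
theorem sgn_injective' {b b' : Bool} (h : (sgn b : ℤ) = sgn b') : b = b' := by
  cases b <;> cases b' <;> simp at h ⊢

end Matsumoto

open Matsumoto in
/-- **The descent step.**  A four-letter genus-one word with two letters of each sign and trivial
monodromy which is not terminal admits a signed Hurwitz move strictly decreasing the complexity
`S4` (signs travel with the letters). [folklore] -/
theorem helper_descent_step (v₁ v₂ v₃ v₄ : Fin 1 ⊕ Fin 1 → ℤ) (b₁ b₂ b₃ b₄ : Bool)
    (h : wordProduct (stdSymp ℤ 1) [(v₁, b₁), (v₂, b₂), (v₃, b₃), (v₄, b₄)] = 1)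
    (h22 : (sgn b₁ : ℤ) + sgn b₂ + sgn b₃ + sgn b₄ = 0)
    (hna : b₁ ≠ b₂ → (stdSymp ℤ 1) v₁ v₂ ≠ 0) (hnd : b₂ ≠ b₃ →
        (stdSymp ℤ 1) v₂ v₃ ≠ 0) (hnc : b₁ ≠ b₄ → (stdSymp ℤ 1) v₁ v₄ ≠ 0) :
    ∃ (w₁ w₂ w₃ w₄ : Fin 1 ⊕ Fin 1 → ℤ) (c₁ c₂ c₃ c₄ : Bool),
      HurwitzStep (stdSymp ℤ 1) [(v₁, b₁), (v₂, b₂), (v₃, b₃), (v₄, b₄)]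
        [(w₁, c₁), (w₂, c₂), (w₃, c₃), (w₄, c₄)] ∧
      |(stdSymp ℤ 1) w₁ w₂| + |(stdSymp ℤ 1) w₁ w₃| + |(stdSymp ℤ 1) w₁ w₄| +
        |(stdSymp ℤ 1) w₂ w₃| + |(stdSymp ℤ 1) w₂ w₄| + |(stdSymp ℤ 1) w₃ w₄| <
      |(stdSymp ℤ 1) v₁ v₂| + |(stdSymp ℤ 1) v₁ v₃| + |(stdSymp ℤ 1) v₁ v₄| +
        |(stdSymp ℤ 1) v₂ v₃| + |(stdSymp ℤ 1) v₂ v₄| + |(stdSymp ℤ 1) v₃ v₄| ∧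
      (sgn c₁ : ℤ) + sgn c₂ + sgn c₃ + sgn c₄ = 0 := by
  show ∃ (w₁ w₂ w₃ w₄ : Fin 1 ⊕ Fin 1 → ℤ) (c₁ c₂ c₃ c₄ : Bool),
      HurwitzStep (stdSymp ℤ 1) [(v₁, b₁), (v₂, b₂), (v₃, b₃), (v₄, b₄)]
        [(w₁, c₁), (w₂, c₂), (w₃, c₃), (w₄, c₄)] ∧
      S4 w₁ w₂ w₃ w₄ < S4 v₁ v₂ v₃ v₄ ∧ (sgn c₁ : ℤ) + sgn c₂ + sgn c₃ + sgn c₄ = 0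
  -- the seven identities
  have hPL : (stdSymp ℤ 1) v₁ v₂ * (stdSymp ℤ 1) v₃ v₄ -
      (stdSymp ℤ 1) v₁ v₃ * (stdSymp ℤ 1) v₂ v₄ + (stdSymp ℤ 1) v₁ v₄ * (stdSymp ℤ 1) v₂ v₃ = 0 :=
      om_pluecker v₁ v₂ v₃ v₄
  have hA11 : -sgn b₂ * ((stdSymp ℤ 1) v₁ v₂) ^ 2 =
      sgn b₃ * ((stdSymp ℤ 1) v₁ v₃) ^ 2 + sgn b₄ * ((stdSymp ℤ 1) v₁ v₄) ^ 2 +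
      sgn b₃ * sgn b₄ * (stdSymp ℤ 1) v₃ v₄ * (stdSymp ℤ 1) v₁ v₃ * (stdSymp ℤ 1) v₁ v₄ := by
    have := helper_fund_identity h v₁ v₁; simp only [om_apply] at this ⊢; linear_combination this
  have hA12 : (0 : ℤ) =
      sgn b₃ * (stdSymp ℤ 1) v₁ v₃ * (stdSymp ℤ 1) v₂ v₃ +
      sgn b₄ * (stdSymp ℤ 1) v₁ v₄ * (stdSymp ℤ 1) v₂ v₄ +
      sgn b₃ * sgn b₄ * (stdSymp ℤ 1) v₃ v₄ * (stdSymp ℤ 1) v₁ v₄ * (stdSymp ℤ 1) v₂ v₃ := by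
    have := helper_fund_identity h v₁ v₂; simp only [om_apply] at this ⊢; linear_combination this
  have hA21 : sgn b₁ * sgn b₂ * ((stdSymp ℤ 1) v₁ v₂) ^ 3 =
      sgn b₃ * (stdSymp ℤ 1) v₁ v₃ * (stdSymp ℤ 1) v₂ v₃ +
      sgn b₄ * (stdSymp ℤ 1) v₁ v₄ * (stdSymp ℤ 1) v₂ v₄ +
      sgn b₃ * sgn b₄ * (stdSymp ℤ 1) v₃ v₄ * (stdSymp ℤ 1) v₁ v₃ * (stdSymp ℤ 1) v₂ v₄ := by
    have := helper_fund_identity h v₂ v₁; simp only [om_apply] at this ⊢; linear_combination this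
  have h' : wordProduct (stdSymp ℤ 1) [(v₄, b₄), (v₁, b₁), (v₂, b₂), (v₃, b₃)] = 1 :=
    prod_rotate (prod_rotate (prod_rotate h))
  have hD12 : (0 : ℤ) =
      -sgn b₂ * (stdSymp ℤ 1) v₁ v₂ * (stdSymp ℤ 1) v₂ v₄ -
      sgn b₃ * (stdSymp ℤ 1) v₁ v₃ * (stdSymp ℤ 1) v₃ v₄ -
      sgn b₂ * sgn b₃ * (stdSymp ℤ 1) v₁ v₂ * (stdSymp ℤ 1) v₂ v₃ * (stdSymp ℤ 1) v₃ v₄ := by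
    have := helper_fund_identity h' v₄ v₁; simp only [om_apply] at this ⊢; linear_combination this
  have hD21 : -sgn b₁ * sgn b₄ * ((stdSymp ℤ 1) v₁ v₄) ^ 3 =
      -sgn b₂ * (stdSymp ℤ 1) v₁ v₂ * (stdSymp ℤ 1) v₂ v₄ -
      sgn b₃ * (stdSymp ℤ 1) v₁ v₃ * (stdSymp ℤ 1) v₃ v₄ -
      sgn b₂ * sgn b₃ * (stdSymp ℤ 1) v₁ v₃ * (stdSymp ℤ 1) v₂ v₃ * (stdSymp ℤ 1) v₂ v₄ := by
    have := helper_fund_identity h' v₁ v₄; simp only [om_apply] at this ⊢; linear_combination this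
  have hD22 : -sgn b₄ * ((stdSymp ℤ 1) v₁ v₄) ^ 2 =
      sgn b₂ * ((stdSymp ℤ 1) v₁ v₂) ^ 2 + sgn b₃ * ((stdSymp ℤ 1) v₁ v₃) ^ 2 +
      sgn b₂ * sgn b₃ * (stdSymp ℤ 1) v₂ v₃ * (stdSymp ℤ 1) v₁ v₂ * (stdSymp ℤ 1) v₁ v₃ := by
    have := helper_fund_identity h' v₁ v₁; simp only [om_apply] at this ⊢; linear_combination this
  have hM := helper_arith_moves ((stdSymp ℤ 1) v₁ v₂) ((stdSymp ℤ 1) v₁ v₃) ((stdSymp ℤ 1) v₁ v₄)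
      ((stdSymp ℤ 1) v₂ v₃) ((stdSymp ℤ 1) v₂ v₄) ((stdSymp ℤ 1) v₃ v₄)
    (sgn b₁) (sgn b₂) (sgn b₃) (sgn b₄) (sgn_eq_or b₁) (sgn_eq_or b₂) (sgn_eq_or b₃) (sgn_eq_or b₄)
    h22 hPL hA11 hA12 hA21 hD12 hD21 hD22
    (fun hne => hna fun heq => hne (by rw [heq])) (fun hne => hnd fun heq => hne (by rw [heq]))
    (fun hne => hnc fun heq => hne (by rw [heq]))
  rcases hM with hM | hM | hM | hM | hM | hM
  · -- move (12), first alternative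
    refine ⟨v₂ + (sgn b₁ * (stdSymp ℤ 1) v₁ v₂) • v₁, v₁, v₃, v₄, b₂, b₁, b₃, b₄,
      ⟨[], [(v₃, b₃), (v₄, b₄)], (v₁, b₁), (v₂, b₂), rfl, Or.inl rfl⟩, ?_, by linarith⟩
    have e1 : (stdSymp ℤ 1) (v₂ + (sgn b₁ * (stdSymp ℤ 1) v₁ v₂) • v₁) v₁ = -(stdSymp ℤ 1) v₁ v₂ :=
        by
      rw [om_add_smul_left, stdSymp_int_self, stdSymp_int_swap 1 v₂ v₁]; ring
    have e2 : (stdSymp ℤ 1) (v₂ + (sgn b₁ * (stdSymp ℤ 1) v₁ v₂) • v₁) v₃ =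
        (stdSymp ℤ 1) v₂ v₃ + sgn b₁ * (stdSymp ℤ 1) v₁ v₂ * (stdSymp ℤ 1) v₁ v₃ := by
      rw [om_add_smul_left]
    have e3 : (stdSymp ℤ 1) (v₂ + (sgn b₁ * (stdSymp ℤ 1) v₁ v₂) • v₁) v₄ =
        (stdSymp ℤ 1) v₂ v₄ + sgn b₁ * (stdSymp ℤ 1) v₁ v₂ * (stdSymp ℤ 1) v₁ v₄ := by
      rw [om_add_smul_left]
    simp only [S4, e1, e2, e3, abs_neg]
    linarith
  · -- move (12), second alternative
    refine ⟨v₂, v₁ - (sgn b₂ * (stdSymp ℤ 1) v₂ v₁) • v₂, v₃, v₄, b₂, b₁, b₃, b₄,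
      ⟨[], [(v₃, b₃), (v₄, b₄)], (v₁, b₁), (v₂, b₂), rfl, Or.inr rfl⟩, ?_, by linarith⟩
    have e1 : (stdSymp ℤ 1) v₂ (v₁ - (sgn b₂ * (stdSymp ℤ 1) v₂ v₁) • v₂) = -(stdSymp ℤ 1) v₁ v₂ :=
        by
      rw [om_sub_smul_right, stdSymp_int_self, stdSymp_int_swap 1 v₂ v₁]; ring
    have e2 : (stdSymp ℤ 1) (v₁ - (sgn b₂ * (stdSymp ℤ 1) v₂ v₁) • v₂) v₃ =
        (stdSymp ℤ 1) v₁ v₃ + sgn b₂ * (stdSymp ℤ 1) v₁ v₂ * (stdSymp ℤ 1) v₂ v₃ := by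
      rw [om_sub_smul_left, stdSymp_int_swap 1 v₂ v₁]; ring
    have e3 : (stdSymp ℤ 1) (v₁ - (sgn b₂ * (stdSymp ℤ 1) v₂ v₁) • v₂) v₄ =
        (stdSymp ℤ 1) v₁ v₄ + sgn b₂ * (stdSymp ℤ 1) v₁ v₂ * (stdSymp ℤ 1) v₂ v₄ := by
      rw [om_sub_smul_left, stdSymp_int_swap 1 v₂ v₁]; ring
    simp only [S4, e1, e2, e3, abs_neg]
    linarith
  · -- move (23), first alternative
    refine ⟨v₁, v₃ + (sgn b₂ * (stdSymp ℤ 1) v₂ v₃) • v₂, v₂, v₄, b₁, b₃, b₂, b₄,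
      ⟨[(v₁, b₁)], [(v₄, b₄)], (v₂, b₂), (v₃, b₃), rfl, Or.inl rfl⟩, ?_, by linarith⟩
    have e1 : (stdSymp ℤ 1) v₁ (v₃ + (sgn b₂ * (stdSymp ℤ 1) v₂ v₃) • v₂) =
        (stdSymp ℤ 1) v₁ v₃ + sgn b₂ * (stdSymp ℤ 1) v₂ v₃ * (stdSymp ℤ 1) v₁ v₂ := by
      rw [om_add_smul_right]
    have e2 : (stdSymp ℤ 1) (v₃ + (sgn b₂ * (stdSymp ℤ 1) v₂ v₃) • v₂) v₂ = -(stdSymp ℤ 1) v₂ v₃ :=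
        by
      rw [om_add_smul_left, stdSymp_int_self, stdSymp_int_swap 1 v₃ v₂]; ring
    have e3 : (stdSymp ℤ 1) (v₃ + (sgn b₂ * (stdSymp ℤ 1) v₂ v₃) • v₂) v₄ =
        (stdSymp ℤ 1) v₃ v₄ + sgn b₂ * (stdSymp ℤ 1) v₂ v₃ * (stdSymp ℤ 1) v₂ v₄ := by
      rw [om_add_smul_left]
    simp only [S4, e1, e2, e3, abs_neg]
    linarith
  · -- move (23), second alternative
    refine ⟨v₁, v₃, v₂ - (sgn b₃ * (stdSymp ℤ 1) v₃ v₂) • v₃, v₄, b₁, b₃, b₂, b₄,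
      ⟨[(v₁, b₁)], [(v₄, b₄)], (v₂, b₂), (v₃, b₃), rfl, Or.inr rfl⟩, ?_, by linarith⟩
    have e1 : (stdSymp ℤ 1) v₁ (v₂ - (sgn b₃ * (stdSymp ℤ 1) v₃ v₂) • v₃) =
        (stdSymp ℤ 1) v₁ v₂ + sgn b₃ * (stdSymp ℤ 1) v₂ v₃ * (stdSymp ℤ 1) v₁ v₃ := by
      rw [om_sub_smul_right, stdSymp_int_swap 1 v₃ v₂]; ring
    have e2 : (stdSymp ℤ 1) v₃ (v₂ - (sgn b₃ * (stdSymp ℤ 1) v₃ v₂) • v₃) = -(stdSymp ℤ 1) v₂ v₃ :=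
        by
      rw [om_sub_smul_right, stdSymp_int_self, stdSymp_int_swap 1 v₃ v₂]; ring
    have e3 : (stdSymp ℤ 1) (v₂ - (sgn b₃ * (stdSymp ℤ 1) v₃ v₂) • v₃) v₄ =
        (stdSymp ℤ 1) v₂ v₄ + sgn b₃ * (stdSymp ℤ 1) v₂ v₃ * (stdSymp ℤ 1) v₃ v₄ := by
      rw [om_sub_smul_left, stdSymp_int_swap 1 v₃ v₂]; ring
    simp only [S4, e1, e2, e3, abs_neg]
    linarith
  · -- move (34), first alternative
    refine ⟨v₁, v₂, v₄ + (sgn b₃ * (stdSymp ℤ 1) v₃ v₄) • v₃, v₃, b₁, b₂, b₄, b₃,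
      ⟨[(v₁, b₁), (v₂, b₂)], [], (v₃, b₃), (v₄, b₄), rfl, Or.inl rfl⟩, ?_, by linarith⟩
    have e1 : (stdSymp ℤ 1) v₁ (v₄ + (sgn b₃ * (stdSymp ℤ 1) v₃ v₄) • v₃) =
        (stdSymp ℤ 1) v₁ v₄ + sgn b₃ * (stdSymp ℤ 1) v₃ v₄ * (stdSymp ℤ 1) v₁ v₃ := by
      rw [om_add_smul_right]
    have e2 : (stdSymp ℤ 1) v₂ (v₄ + (sgn b₃ * (stdSymp ℤ 1) v₃ v₄) • v₃) =
        (stdSymp ℤ 1) v₂ v₄ + sgn b₃ * (stdSymp ℤ 1) v₃ v₄ * (stdSymp ℤ 1) v₂ v₃ := by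
      rw [om_add_smul_right]
    have e3 : (stdSymp ℤ 1) (v₄ + (sgn b₃ * (stdSymp ℤ 1) v₃ v₄) • v₃) v₃ = -(stdSymp ℤ 1) v₃ v₄ :=
        by
      rw [om_add_smul_left, stdSymp_int_self, stdSymp_int_swap 1 v₄ v₃]; ring
    simp only [S4, e1, e2, e3, abs_neg]
    linarith
  · -- move (34), second alternative
    refine ⟨v₁, v₂, v₄, v₃ - (sgn b₄ * (stdSymp ℤ 1) v₄ v₃) • v₄, b₁, b₂, b₄, b₃,
      ⟨[(v₁, b₁), (v₂, b₂)], [], (v₃, b₃), (v₄, b₄), rfl, Or.inr rfl⟩, ?_, by linarith⟩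
    have e1 : (stdSymp ℤ 1) v₁ (v₃ - (sgn b₄ * (stdSymp ℤ 1) v₄ v₃) • v₄) =
        (stdSymp ℤ 1) v₁ v₃ + sgn b₄ * (stdSymp ℤ 1) v₃ v₄ * (stdSymp ℤ 1) v₁ v₄ := by
      rw [om_sub_smul_right, stdSymp_int_swap 1 v₄ v₃]; ring
    have e2 : (stdSymp ℤ 1) v₂ (v₃ - (sgn b₄ * (stdSymp ℤ 1) v₄ v₃) • v₄) =
        (stdSymp ℤ 1) v₂ v₃ + sgn b₄ * (stdSymp ℤ 1) v₃ v₄ * (stdSymp ℤ 1) v₂ v₄ := by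
      rw [om_sub_smul_right, stdSymp_int_swap 1 v₄ v₃]; ring
    have e3 : (stdSymp ℤ 1) v₄ (v₃ - (sgn b₄ * (stdSymp ℤ 1) v₄ v₃) • v₄) = -(stdSymp ℤ 1) v₃ v₄ :=
        by
      rw [om_sub_smul_right, stdSymp_int_self, stdSymp_int_swap 1 v₄ v₃]; ring
    simp only [S4, e1, e2, e3, abs_neg]
    linarith

end Summit.SmoothPoincare4.SmoothPoincare4.Theorems.AcyclicBisectionRigidity.FoldedCurveBranchLocus
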